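import Mathlib.NumberTheory.Transcendental.Liouville.LiouvilleNumber
import Mathlib.RingTheory.IntegralClosure.IsIntegralClosure.Basic
import Mathlib.RingTheory.AlgebraicIndependent.Transcendental
import Literature.NumberTheory.Transcendental.ChudnovskyPeriods
import Literature.NumberTheory.Transcendental.ChudnovskyMainAux
import Literature.NumberTheory.Transcendental.ChudnovskyEnvelope
import Literature.NumberTheory.EllipticCurves.WeierstrassZetaLegendre
import HarnessLib

/-!
# Chudnovsky's theorem on periods — the main argument

Topic `Literature/NumberTheory/Transcendental` (trunk T-TRANSCEND). Node [MAIN] of the proof of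
`Literature.NumberTheory.Transcendental.Chudnovsky1984_thm_7_3_1` (Chudnovsky 1984, Ch. 7, Theorem 3.1) and of the named
fact `Literature.NumberTheory.Transcendental.chudnovsky` (`KontsevichZagier.lean`, **periods.S31**; Chudnovsky 1976 =
Chudnovsky 1984, Ch. 7, Thm 1.16 / Thm 2.1).

The proof is Gelfond's method in the form of Chudnovsky 1984, Ch. 7, §2 (variant (C),
pp. 307–308) and §3 (pp. 309–310), with the numbers `x = (κ, g₂/2, c, e₁)`
(`κ = η₁/ω₁`, `c = η₂ - κω₂ = ∓2πi/ω₁`, `e₁ = ℘(ω₁/2)`): assuming that no two of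
`g₂, g₃, π/ω₁, η₁/ω₁` are algebraically independent, all four `x_l` are algebraic over `ℚ(θ)`
for a transcendental `θ` (`exists_theta`), which gives an `Envelope θ x`
(`ChudnovskyEnvelope.lean`). At each level `D ≥ D₀` one then constructs (`exists_level_bounds`):
Siegel's lemma → an auxiliary function `F_p` with zeros of order `T₀ ≍ D` at `X ≍ D` points
`s_m`; the zero estimate → a nonzero value `ξ = F_p^{(j₀)}(s_{m₀})`, `j₀ = O(D)`; Schwarz's
 lemma → `log |ξ| ≤ -γ D³`; the norm → `Q_D ∈ ℤ[T]`, `Q_D ≠ 0`, `deg Q_D = O(D)`,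
`log H(Q_D) = O(D^{3/2})`, `log |Q_D(θ)| ≤ -γ D³`. Gelfond's criterion
(`GelfondCriterionProofs.lean`, with `δ_N ≍ N`, `σ_N ≍ N^{3/2}`, `a = 2`) then makes `θ`
algebraic — a contradiction (`core`). Finally `chudnovsky_holds` follows from Theorem 3.1 by the
reductions of `ChudnovskyPeriods.lean` and the Legendre relation (`WeierstrassZetaLegendre.lean`).

## Contents (no definitions)

* arithmetic lemmas for the parameters (`params_ok`, `T₁_ok`, `main_term`, `Omega_facts`,
  `params_M_bounds`, `final_ineq`) and the bookkeeping currency (`currency_B`, `currency_Cf`,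
  `currency_HY`, `currency_zl1`, `currency_c3`);
* `level_struct`, `exists_level_bounds` — the construction at level `D`;
* `sigma_ratio`, `gelfond_gap`, `core` — Gelfond's criterion and the contradiction;
* `transcendental_ofReal`, `exists_transcendental`, `exists_theta`, `isAlgebraic_xv` — the
  reduction to a transcendental `θ`;
* `Chudnovsky1984_thm_7_3_1_holds`, `Chudnovsky1984_thm_7_2_6_holds`, `chudnovsky_holds`, and
  the alias `Literature.NumberTheory.Transcendental.chudnovsky_holds`.
-/

noncomputable section

open scoped Polynomial IntermediateField
open Complex Finset MvPolynomial Matrix Filter Topology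

namespace Literature.NumberTheory.Transcendental.Chudnovsky


/-! ### Arithmetic of the parameters -/

/-- `log (Ω s²) ≤ 2 Ω s` for `Ω ≥ 2`, `s ≥ 1`. [folklore] -/
lemma log_mul_sq_le {Ω s : ℝ} (hΩ : 2 ≤ Ω) (hs : 1 ≤ s) : Real.log (Ω * s ^ 2) ≤ 2 * Ω * s := by
  have hΩ0 : 0 < Ω := by linarith
  have hs0 : 0 < s := by linarith
  rw [Real.log_mul hΩ0.ne' (by positivity), Real.log_pow]
  have h1 : Real.log Ω ≤ Ω := Real.log_le_self hΩ0.le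
  have h2 : Real.log s ≤ s := Real.log_le_self hs0.le
  push_cast
  nlinarith

/-- Powers in the bookkeeping currency: `q ≤ M`, `e ≤ e'`, `1 ≤ M`, `0 ≤ q` give
`q^e ≤ M^{e'}`. [folklore] -/
lemma pow_le_pow_of_le {q M : ℝ} {e e' : ℕ} (hq : 0 ≤ q) (hqM : q ≤ M) (hM : 1 ≤ M)
    (he : e ≤ e') : q ^ e ≤ M ^ e' :=
  (pow_le_pow_left₀ hq hqM e).trans (pow_le_pow_right₀ hM he)

/-- `n! ≤ M^M` if `n ≤ M`. [folklore] -/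
lemma factorial_le_pow_of_le {n M : ℕ} (h : n ≤ M) (hM : 1 ≤ M) :
    ((n.factorial : ℕ) : ℝ) ≤ (M : ℝ) ^ M := by
  have h1 : ((n.factorial : ℕ) : ℝ) ≤ (n : ℝ) ^ n := by exact_mod_cast Nat.factorial_le_pow n
  refine h1.trans ?_
  rcases Nat.eq_zero_or_pos n with rfl | hn
  · simp only [pow_zero, CharP.cast_eq_zero]
    exact one_le_pow₀ (by exact_mod_cast hM)
  · exact pow_le_pow_of_le (Nat.cast_nonneg _) (by exact_mod_cast h) (by exact_mod_cast hM) h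

/-- The choice of `T₀ = ⌈γ₁(D+1)⌉`, `X = ⌈γ₂(D+1)⌉` with `γ₂ ≤ 1/(16 d² (γ₁+1))` and
`γ₂ (D+1) ≥ 1`: then `1 ≤ T₀, X`, `γ₁(D+1) ≤ T₀ ≤ (γ₁+1)(D+1)`, `γ₂(D+1) ≤ X ≤ 2γ₂(D+1)` and
the Siegel count `8 T₀ X d² ≤ (D+1)²` holds. [folklore] -/
theorem params_ok {γ₁ γ₂ : ℝ} {d D : ℕ} (hγ₁ : 1 ≤ γ₁) (hγ₂ : 0 < γ₂) (hd : 1 ≤ d)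
    (hγ₂le : γ₂ * (16 * (d : ℝ) ^ 2 * (γ₁ + 1)) ≤ 1) (hD : 1 ≤ γ₂ * (D + 1)) :
    1 ≤ ⌈γ₁ * (D + 1)⌉₊ ∧ 1 ≤ ⌈γ₂ * (D + 1)⌉₊ ∧
      γ₁ * (D + 1) ≤ ⌈γ₁ * (D + 1)⌉₊ ∧ (⌈γ₁ * (D + 1)⌉₊ : ℝ) ≤ (γ₁ + 1) * (D + 1) ∧
      γ₂ * (D + 1) ≤ ⌈γ₂ * (D + 1)⌉₊ ∧ (⌈γ₂ * (D + 1)⌉₊ : ℝ) ≤ 2 * γ₂ * (D + 1) ∧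
      8 * (⌈γ₁ * (D + 1)⌉₊ * ⌈γ₂ * (D + 1)⌉₊ * d ^ 2) ≤ (D + 1) ^ 2 := by
  have hD0 : (0 : ℝ) ≤ D := Nat.cast_nonneg D
  have hD1 : (1 : ℝ) ≤ D + 1 := by linarith
  set T₀ := ⌈γ₁ * (D + 1)⌉₊ with hT₀
  set X := ⌈γ₂ * (D + 1)⌉₊ with hX
  have hT₀ge : γ₁ * (D + 1) ≤ T₀ := Nat.le_ceil _
  have hXge : γ₂ * (D + 1) ≤ X := Nat.le_ceil _
  have hT₀lt : (T₀ : ℝ) < γ₁ * (D + 1) + 1 := Nat.ceil_lt_add_one (by positivity)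
  have hXlt : (X : ℝ) < γ₂ * (D + 1) + 1 := Nat.ceil_lt_add_one (by positivity)
  have hT₀le : (T₀ : ℝ) ≤ (γ₁ + 1) * (D + 1) := by nlinarith
  have hXle : (X : ℝ) ≤ 2 * γ₂ * (D + 1) := by linarith
  have h1T₀ : 1 ≤ T₀ := by
    have : (1 : ℝ) ≤ T₀ := le_trans (by nlinarith) hT₀ge
    exact_mod_cast this
  have h1X : 1 ≤ X := by
    have : (1 : ℝ) ≤ X := le_trans hD hXge
    exact_mod_cast this
  refine ⟨h1T₀, h1X, hT₀ge, hT₀le, hXge, hXle, ?_⟩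
  have hd' : (1 : ℝ) ≤ d := by exact_mod_cast hd
  have key : (8 : ℝ) * (T₀ * X * (d : ℝ) ^ 2) ≤ ((D : ℝ) + 1) ^ 2 := by
    calc (8 : ℝ) * (T₀ * X * (d : ℝ) ^ 2)
        ≤ 8 * (((γ₁ + 1) * (D + 1)) * (2 * γ₂ * (D + 1)) * (d : ℝ) ^ 2) := by
          gcongr
      _ = (γ₂ * (16 * (d : ℝ) ^ 2 * (γ₁ + 1))) * ((D : ℝ) + 1) ^ 2 := by ring
      _ ≤ 1 * ((D : ℝ) + 1) ^ 2 := by gcongr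
      _ = ((D : ℝ) + 1) ^ 2 := one_mul _
  exact_mod_cast key

/-- The choice of `T₁ = ⌈C_Z (D+1)(1 + 1/γ₂)²⌉ + 1`: since `D ≤ X/γ₂`,
`C_Z (D+1)(X+D)² < T₁ X²`. [folklore] -/
theorem T₁_ok {C_Z γ₂ : ℝ} {D X : ℕ} (hC_Z : 0 ≤ C_Z) (hγ₂ : 0 < γ₂) (hX1 : 1 ≤ X)
    (hX : γ₂ * (D + 1) ≤ X) :
    C_Z * (D + 1) * ((X : ℝ) + D) ^ 2 <
      ((⌈C_Z * (D + 1) * (1 + 1 / γ₂) ^ 2⌉₊ + 1 : ℕ) : ℝ) * (X : ℝ) ^ 2 := by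
  have hD0 : (0 : ℝ) ≤ D := Nat.cast_nonneg D
  have hX1' : (1 : ℝ) ≤ X := by exact_mod_cast hX1
  have hX0 : (0 : ℝ) < X := by linarith
  have hDX : (D : ℝ) ≤ X / γ₂ := by
    rw [le_div_iff₀ hγ₂]; nlinarith
  have hXD : (X : ℝ) + D ≤ X * (1 + 1 / γ₂) := by
    rw [mul_add, mul_one, mul_one_div]; linarith
  have hXD0 : 0 ≤ (X : ℝ) + D := by positivity
  have hceil : C_Z * (D + 1) * (1 + 1 / γ₂) ^ 2 <
      ((⌈C_Z * (D + 1) * (1 + 1 / γ₂) ^ 2⌉₊ + 1 : ℕ) : ℝ) := by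
    push_cast
    exact (Nat.le_ceil _).trans_lt (lt_add_one _)
  calc C_Z * (D + 1) * ((X : ℝ) + D) ^ 2 ≤ C_Z * (D + 1) * (X * (1 + 1 / γ₂)) ^ 2 := by
        gcongr
    _ = C_Z * (D + 1) * (1 + 1 / γ₂) ^ 2 * (X : ℝ) ^ 2 := by ring
    _ < _ := by gcongr

/-- **The main term.** With `T₀ ≥ γ₁ (D+1)`, `γ₁ = 4 C_A + 2`, `X ≥ γ₂ (D+1)` and
`D + 1 ≥ s²/2`: `C_A (D+1) X² - T₀ X² ≤ -γ₂² s⁶/4`. [folklore] -/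
theorem main_term {C_A γ₂ s : ℝ} {D T₀ X : ℕ} (hC_A : 0 ≤ C_A) (hγ₂ : 0 < γ₂)
    (hT₀ : (4 * C_A + 2) * (D + 1) ≤ T₀) (hX : γ₂ * (D + 1) ≤ X)
    (hs : s ^ 2 ≤ 2 * ((D : ℝ) + 1)) :
    C_A * (((D : ℝ) + 1) * (X : ℝ) ^ 2) - (T₀ : ℝ) * (X : ℝ) ^ 2 ≤ -(γ₂ ^ 2 * s ^ 6 / 4) := by
  have hD0 : (0 : ℝ) ≤ D := Nat.cast_nonneg D
  have hX2 : 0 ≤ (X : ℝ) ^ 2 := sq_nonneg _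
  have hT₀X := mul_le_mul_of_nonneg_right hT₀ hX2
  have hCX : 0 ≤ C_A * (((D : ℝ) + 1) * (X : ℝ) ^ 2) := by positivity
  have h1 : C_A * (((D : ℝ) + 1) * (X : ℝ) ^ 2) - (T₀ : ℝ) * (X : ℝ) ^ 2 ≤
      -(2 * ((D : ℝ) + 1) * (X : ℝ) ^ 2) := by nlinarith
  have h2 : γ₂ ^ 2 * ((D : ℝ) + 1) ^ 2 ≤ (X : ℝ) ^ 2 := by
    have h0 : 0 ≤ γ₂ * (D + 1) := by positivity
    have := pow_le_pow_left₀ h0 hX 2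
    nlinarith
  have h3 : s ^ 6 ≤ 8 * ((D : ℝ) + 1) ^ 3 := by
    have := pow_le_pow_left₀ (sq_nonneg s) hs 3
    calc s ^ 6 = (s ^ 2) ^ 3 := by ring
      _ ≤ (2 * ((D : ℝ) + 1)) ^ 3 := this
      _ = 8 * ((D : ℝ) + 1) ^ 3 := by ring
  have h4 : 2 * γ₂ ^ 2 * ((D : ℝ) + 1) ^ 3 ≤ 2 * ((D : ℝ) + 1) * (X : ℝ) ^ 2 := by
    have := mul_le_mul_of_nonneg_left h2 (by positivity : (0 : ℝ) ≤ 2 * ((D : ℝ) + 1))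
    nlinarith
  have h5 : γ₂ ^ 2 * s ^ 6 / 4 ≤ 2 * γ₂ ^ 2 * ((D : ℝ) + 1) ^ 3 := by
    have := mul_le_mul_of_nonneg_left h3 (sq_nonneg γ₂)
    nlinarith
  linarith

/-- The constants dominated by `Ω`. [folklore] -/
lemma Omega_facts {γ₁ cZ dH₀ Θ bθ C_A Ω : ℝ} {δ₀ : ℕ} (hγ₁ : 1 ≤ γ₁) (hcZ : 3 ≤ cZ)
    (hdH₀ : 0 ≤ dH₀) (hΘ : 0 ≤ Θ) (hbθ : 0 ≤ bθ) (hC_A : 0 ≤ C_A)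
    (hΩ : 14 + 7 * (γ₁ + 3) * (δ₀ + 1) + 7 * cZ * (δ₀ + 1) + dH₀ + Θ + bθ + C_A ≤ Ω) :
    14 ≤ Ω ∧ γ₁ + 1 ≤ Ω ∧ cZ ≤ Ω ∧ 7 * (γ₁ + 3) ≤ Ω ∧ 7 * cZ ≤ Ω ∧
      (γ₁ + 3) * δ₀ + 1 ≤ Ω ∧ cZ * δ₀ ≤ Ω ∧ dH₀ ≤ Ω ∧ Θ ≤ Ω ∧ bθ ≤ Ω ∧ C_A ≤ Ω := by
  have hδ : (0 : ℝ) ≤ δ₀ := Nat.cast_nonneg δ₀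
  have h1 : 0 ≤ 7 * (γ₁ + 3) * (δ₀ + 1 : ℝ) := by positivity
  have h2 : 0 ≤ 7 * cZ * (δ₀ + 1 : ℝ) := by nlinarith
  have h3 : 7 * (γ₁ + 3) ≤ 7 * (γ₁ + 3) * (δ₀ + 1 : ℝ) := by nlinarith
  have h4 : 7 * cZ ≤ 7 * cZ * (δ₀ + 1 : ℝ) := by nlinarith
  have h5 : (γ₁ + 3) * δ₀ + 1 ≤ 7 * (γ₁ + 3) * (δ₀ + 1 : ℝ) := by nlinarith
  have h6 : cZ * δ₀ ≤ 7 * cZ * (δ₀ + 1 : ℝ) := by nlinarith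
  refine ⟨by linarith, by linarith, by linarith, by linarith, by linarith, by linarith, by linarith,
    by linarith, by linarith, by linarith, by linarith⟩

/-- The final comparison of the exponents: junk `O(s⁵)` against the main term `γ₂² s⁶/4`.
[folklore] -/
lemma final_ineq {Ω dd γ₂ s : ℝ} (hd : 0 ≤ dd) (hγ₂ : 0 < γ₂) (hs1 : 1 ≤ s)
    (hs : 8 * (32 * Ω ^ 2 * dd + Ω ^ 2) / γ₂ ^ 2 ≤ s) :
    16 * (Ω * s ^ 2) * dd * (2 * Ω * s) + (Ω * s ^ 2) ^ 2 + -(γ₂ ^ 2 * s ^ 6 / 4) ≤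
      -(γ₂ ^ 2 / 8 * (s ^ 2) ^ 3) := by
  set K : ℝ := 32 * Ω ^ 2 * dd + Ω ^ 2 with hK
  have hK0 : 0 ≤ K := by positivity
  have hγ2 : 0 < γ₂ ^ 2 := by positivity
  have h8K : 8 * K ≤ γ₂ ^ 2 * s := by
    rw [div_le_iff₀ hγ2] at hs; linarith
  have hs0 : 0 ≤ s := by linarith
  have hs5 : 0 ≤ s ^ 5 := by positivity
  have h1 : 8 * K * s ^ 5 ≤ γ₂ ^ 2 * s ^ 6 := by nlinarith
  have h35 : s ^ 3 ≤ s ^ 5 := pow_le_pow_right₀ hs1 (by norm_num)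
  have h45 : s ^ 4 ≤ s ^ 5 := pow_le_pow_right₀ hs1 (by norm_num)
  have hA : 16 * (Ω * s ^ 2) * dd * (2 * Ω * s) = 32 * Ω ^ 2 * dd * s ^ 3 := by ring
  have hB : (Ω * s ^ 2) ^ 2 = Ω ^ 2 * s ^ 4 := by ring
  rw [hA, hB]
  have h2 : 32 * Ω ^ 2 * dd * s ^ 3 ≤ 32 * Ω ^ 2 * dd * s ^ 5 :=
    mul_le_mul_of_nonneg_left h35 (by positivity)
  have h3 : Ω ^ 2 * s ^ 4 ≤ Ω ^ 2 * s ^ 5 := mul_le_mul_of_nonneg_left h45 (by positivity)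
  nlinarith

/-- The basic parameters are `O(D+2)` with explicit constants (inputs of the currency
bookkeeping). [folklore] -/
lemma params_M_bounds {D T₀ X T₁ γ₁ γ₂ C_Z g δ₀ : ℝ} (hD : 0 ≤ D) (hγ₁ : 1 ≤ γ₁)
    (hγ₂half : 2 * γ₂ ≤ 1) (hC_Z : 0 ≤ C_Z) (hg : 0 ≤ g) (hδ₀ : 0 ≤ δ₀)
    (hT₀ : T₀ ≤ (γ₁ + 1) * (D + 1)) (hX : X ≤ 2 * γ₂ * (D + 1))
    (hT₁ : T₁ ≤ C_Z * (D + 1) * g + 2) :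
    X ≤ 1 * (D + 2) ∧ T₁ ≤ (C_Z * g + 1) * (D + 2) ∧
      7 * (D + D + T₀) ≤ 7 * (γ₁ + 3) * (D + 2) ∧
      7 * (D + D + T₁) ≤ 7 * (C_Z * g + 3) * (D + 2) ∧
      (D + D + T₀) * δ₀ + 1 ≤ ((γ₁ + 3) * δ₀ + 1) * (D + 2) ∧
      (D + D + T₁) * δ₀ ≤ (C_Z * g + 3) * δ₀ * (D + 2) := by
  have h1 : X ≤ D + 1 := by nlinarith
  have h2 : T₁ ≤ (C_Z * g + 1) * (D + 2) := by nlinarith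
  have h3 : D + D + T₀ ≤ (γ₁ + 3) * (D + 2) := by nlinarith
  have h4 : D + D + T₁ ≤ (C_Z * g + 3) * (D + 2) := by nlinarith
  refine ⟨by linarith, h2, by linarith, by linarith, ?_, ?_⟩
  · have := mul_le_mul_of_nonneg_right h3 hδ₀
    nlinarith
  · have := mul_le_mul_of_nonneg_right h4 hδ₀
    nlinarith

/-- Currency, step 1: the Siegel coefficient bound
`B = (7n₀)^{n₀} X^{n₀} d³ (dH₀)^{n₀} ≤ M^{3M+3}`. [folklore] -/
theorem currency_B {D T₀ X M d : ℕ} {H₀ : ℝ} (hd : 1 ≤ d) (hH₀ : 1 ≤ H₀) (hM : 1 ≤ M)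
    (hXM : X ≤ M) (hn₀M : 7 * (D + D + T₀) ≤ M) (hdM : (d : ℝ) * H₀ ≤ M) :
    (7 * ((D : ℝ) + D + T₀)) ^ (D + D + T₀) * (X : ℝ) ^ (D + D + T₀) *
        ((d : ℝ) ^ 3 * (d * H₀) ^ (D + D + T₀)) ≤ (M : ℝ) ^ (3 * M + 3) := by
  have hM1 : (1 : ℝ) ≤ M := by exact_mod_cast hM
  have hM0 : (0 : ℝ) ≤ M := by linarith
  have hd' : (1 : ℝ) ≤ d := by exact_mod_cast hd
  have hn₀le : D + D + T₀ ≤ M := by omega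
  have h7n₀ : 7 * ((D : ℝ) + D + T₀) ≤ M := by
    have : ((7 * (D + D + T₀) : ℕ) : ℝ) ≤ M := by exact_mod_cast hn₀M
    push_cast at this; linarith
  have hXr : (X : ℝ) ≤ M := by exact_mod_cast hXM
  have hdr : (d : ℝ) ≤ M := le_trans (by nlinarith) hdM
  have hP : ∀ k : ℕ, 0 ≤ (M : ℝ) ^ k := fun k => pow_nonneg hM0 k
  have h1 : (7 * ((D : ℝ) + D + T₀)) ^ (D + D + T₀) ≤ (M : ℝ) ^ M :=
    pow_le_pow_of_le (by positivity) h7n₀ hM1 hn₀le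
  have h2 : (X : ℝ) ^ (D + D + T₀) ≤ (M : ℝ) ^ M := pow_le_pow_of_le (by positivity) hXr hM1 hn₀le
  have h3 : (d : ℝ) ^ 3 ≤ (M : ℝ) ^ 3 := pow_le_pow_of_le (by positivity) hdr hM1 le_rfl
  have h4 : ((d : ℝ) * H₀) ^ (D + D + T₀) ≤ (M : ℝ) ^ M :=
    pow_le_pow_of_le (by positivity) hdM hM1 hn₀le
  calc _ ≤ (M : ℝ) ^ M * (M : ℝ) ^ M * ((M : ℝ) ^ 3 * (M : ℝ) ^ M) :=
        mul_le_mul (mul_le_mul h1 h2 (by positivity) (hP _))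
          (mul_le_mul h3 h4 (by positivity) (hP _)) (by positivity) (mul_nonneg (hP _) (hP _))
    _ = (M : ℝ) ^ (3 * M + 3) := by rw [← pow_add, ← pow_add, ← pow_add]; congr 1; ring

/-- Currency, step 2: `C_f = (D+1)² A B ≤ M^{3M+6}`. [folklore] -/
theorem currency_Cf {D T₀ δ₀ M : ℕ} {B : ℝ} (hM : 1 ≤ M) (hDM : D + 2 ≤ M)
    (hAM : (D + D + T₀) * δ₀ + 1 ≤ M) (hB0 : 0 ≤ B) (hB : B ≤ (M : ℝ) ^ (3 * M + 3)) :
    ((D : ℝ) + 1) ^ 2 * (((D + D + T₀) * δ₀ + 1 : ℕ) : ℝ) * B ≤ (M : ℝ) ^ (3 * M + 6) := by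
  have hM1 : (1 : ℝ) ≤ M := by exact_mod_cast hM
  have hM0 : (0 : ℝ) ≤ M := by linarith
  have hD1M : (D : ℝ) + 1 ≤ M := by
    have : D + 1 ≤ M := by omega
    exact_mod_cast this
  have hAr : (((D + D + T₀) * δ₀ + 1 : ℕ) : ℝ) ≤ M := by exact_mod_cast hAM
  have hP : ∀ k : ℕ, 0 ≤ (M : ℝ) ^ k := fun k => pow_nonneg hM0 k
  have h1 : ((D : ℝ) + 1) ^ 2 ≤ (M : ℝ) ^ 2 := pow_le_pow_of_le (by positivity) hD1M hM1 le_rfl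
  calc _ ≤ (M : ℝ) ^ 2 * (M : ℝ) ^ 1 * (M : ℝ) ^ (3 * M + 3) :=
        mul_le_mul (mul_le_mul h1 (by rw [pow_one]; exact hAr) (by positivity) (hP _)) hB hB0
          (mul_nonneg (hP _) (hP _))
    _ = (M : ℝ) ^ (3 * M + 6) := by rw [← pow_add, ← pow_add]; congr 1; ring

/-- Currency, step 3: the entry bound `H_Y = (D+1)² (A C_f) (7n₁)^{n₁} X^{n₁} d³ (dH₀)^{n₁} ≤ M^{6M+12}`.
[folklore] -/
theorem currency_HY {D T₀ T₁ X δ₀ M d : ℕ} {H₀ Cf : ℝ} (hd : 1 ≤ d) (hH₀ : 1 ≤ H₀) (hM : 1 ≤ M)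
    (hDM : D + 2 ≤ M) (hXM : X ≤ M) (hn₁M : 7 * (D + D + T₁) ≤ M)
    (hAM : (D + D + T₀) * δ₀ + 1 ≤ M) (hdM : (d : ℝ) * H₀ ≤ M) (hCf0 : 0 ≤ Cf)
    (hCf : Cf ≤ (M : ℝ) ^ (3 * M + 6)) :
    ((D : ℝ) + 1) ^ 2 * ((((D + D + T₀) * δ₀ + 1 : ℕ) : ℝ) * Cf) *
        ((7 * ((D + D + T₁ : ℕ) : ℝ)) ^ (D + D + T₁) * (X : ℝ) ^ (D + D + T₁)) *
        ((d : ℝ) ^ 3 * (d * H₀) ^ (D + D + T₁)) ≤ (M : ℝ) ^ (6 * M + 12) := by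
  have hM1 : (1 : ℝ) ≤ M := by exact_mod_cast hM
  have hM0 : (0 : ℝ) ≤ M := by linarith
  have hd' : (1 : ℝ) ≤ d := by exact_mod_cast hd
  have hn₁le : D + D + T₁ ≤ M := by omega
  have hD1M : (D : ℝ) + 1 ≤ M := by
    have : D + 1 ≤ M := by omega
    exact_mod_cast this
  have h7n₁ : 7 * ((D + D + T₁ : ℕ) : ℝ) ≤ M := by exact_mod_cast hn₁M
  have hXr : (X : ℝ) ≤ M := by exact_mod_cast hXM
  have hAr : (((D + D + T₀) * δ₀ + 1 : ℕ) : ℝ) ≤ M := by exact_mod_cast hAM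
  have hdr : (d : ℝ) ≤ M := le_trans (by nlinarith) hdM
  have hP : ∀ k : ℕ, 0 ≤ (M : ℝ) ^ k := fun k => pow_nonneg hM0 k
  have h1 : ((D : ℝ) + 1) ^ 2 ≤ (M : ℝ) ^ 2 := pow_le_pow_of_le (by positivity) hD1M hM1 le_rfl
  have h2 : (((D + D + T₀) * δ₀ + 1 : ℕ) : ℝ) * Cf ≤ (M : ℝ) ^ 1 * (M : ℝ) ^ (3 * M + 6) :=
    mul_le_mul (by rw [pow_one]; exact hAr) hCf hCf0 (hP _)
  have h3 : (7 * ((D + D + T₁ : ℕ) : ℝ)) ^ (D + D + T₁) * (X : ℝ) ^ (D + D + T₁) ≤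
      (M : ℝ) ^ M * (M : ℝ) ^ M :=
    mul_le_mul (pow_le_pow_of_le (by positivity) h7n₁ hM1 hn₁le)
      (pow_le_pow_of_le (by positivity) hXr hM1 hn₁le) (by positivity) (hP _)
  have h4 : (d : ℝ) ^ 3 * (d * H₀) ^ (D + D + T₁) ≤ (M : ℝ) ^ 3 * (M : ℝ) ^ M :=
    mul_le_mul (pow_le_pow_of_le (by positivity) hdr hM1 le_rfl)
      (pow_le_pow_of_le (by positivity) hdM hM1 hn₁le) (by positivity) (hP _)
  have h12 : ((D : ℝ) + 1) ^ 2 * ((((D + D + T₀) * δ₀ + 1 : ℕ) : ℝ) * Cf) ≤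
      (M : ℝ) ^ 2 * ((M : ℝ) ^ 1 * (M : ℝ) ^ (3 * M + 6)) :=
    mul_le_mul h1 h2 (mul_nonneg (by positivity) hCf0) (hP _)
  calc _ ≤ (M : ℝ) ^ 2 * ((M : ℝ) ^ 1 * (M : ℝ) ^ (3 * M + 6)) * ((M : ℝ) ^ M * (M : ℝ) ^ M) *
        ((M : ℝ) ^ 3 * (M : ℝ) ^ M) :=
        mul_le_mul (mul_le_mul h12 h3 (by positivity) (mul_nonneg (hP _) (mul_nonneg (hP _) (hP _))))
          h4 (by positivity) (by positivity)
    _ = (M : ℝ) ^ (6 * M + 12) := by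
        simp only [← pow_add]; congr 1; ring

/-- Currency, step 4: `(d H_Y)^d ≤ M^{7Md}`. [folklore] -/
theorem currency_zl1 {M d : ℕ} {HY : ℝ} (hd : 1 ≤ d) (hM : 13 ≤ M) (hdM : (d : ℝ) ≤ M)
    (hHY0 : 0 ≤ HY) (hHY : HY ≤ (M : ℝ) ^ (6 * M + 12)) :
    ((d : ℝ) * HY) ^ d ≤ (M : ℝ) ^ (7 * M * d) := by
  have hM1 : (1 : ℝ) ≤ M := by exact_mod_cast (show 1 ≤ M by omega)
  have hM0 : (0 : ℝ) ≤ M := by linarith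
  have hdHY : (d : ℝ) * HY ≤ (M : ℝ) ^ (7 * M) := by
    calc _ ≤ (M : ℝ) ^ 1 * (M : ℝ) ^ (6 * M + 12) :=
          mul_le_mul (by rw [pow_one]; exact hdM) hHY hHY0 (pow_nonneg hM0 _)
      _ = (M : ℝ) ^ (6 * M + 13) := by rw [← pow_add]; congr 1; ring
      _ ≤ (M : ℝ) ^ (7 * M) := pow_le_pow_right₀ hM1 (by omega)
  calc ((d : ℝ) * HY) ^ d ≤ ((M : ℝ) ^ (7 * M)) ^ d := pow_le_pow_left₀ (by positivity) hdHY d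
    _ = (M : ℝ) ^ (7 * M * d) := by rw [← pow_mul]

/-- Currency, step 5: the upper bound for `|Q(θ)|`:
`|b(θ)|^{n₁} · (A C_f Θ^A · T₁! · e^{C_A((D+1)X²+T₁)} e^{-T₀X²}) · d (1 + d H_Y Θ^{A+n₁δ₀})^d
 ≤ M^{16Md} e^{M²} e^{C_A(D+1)X² - T₀X²}`. [folklore] -/
theorem currency_c3 {D T₀ T₁ X δ₀ M d : ℕ} {Θ bθ C_A Cf HY : ℝ} (hd : 1 ≤ d) (hΘ : 1 ≤ Θ)
    (hbθ0 : 0 ≤ bθ) (hM : 14 ≤ M) (hT₁M : T₁ ≤ M)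
    (hn₁M : 7 * (D + D + T₁) ≤ M) (hAM : (D + D + T₀) * δ₀ + 1 ≤ M)
    (hn₁δM : (D + D + T₁) * δ₀ ≤ M) (hdM : (d : ℝ) ≤ M) (hΘM : Θ ≤ M) (hbθM : bθ ≤ M)
    (hCAM : C_A ≤ M) (hCf0 : 0 ≤ Cf) (hCf : Cf ≤ (M : ℝ) ^ (3 * M + 6)) (hHY0 : 0 ≤ HY)
    (hHY : HY ≤ (M : ℝ) ^ (6 * M + 12)) :
    bθ ^ (D + D + T₁) *
        (((((D + D + T₀) * δ₀ + 1 : ℕ) : ℝ) * Cf * Θ ^ ((D + D + T₀) * δ₀ + 1)) *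
          T₁.factorial * Real.exp (C_A * ((D + 1) * X ^ 2 + T₁)) *
          Real.exp (-(T₀ * X ^ 2 : ℝ))) *
        (d * (1 + d * (HY * Θ ^ (((D + D + T₀) * δ₀ + 1) + (D + D + T₁) * δ₀))) ^ d) ≤
      (M : ℝ) ^ (16 * M * d) * Real.exp ((M : ℝ) ^ 2) *
        Real.exp (C_A * ((D + 1) * (X : ℝ) ^ 2) - T₀ * (X : ℝ) ^ 2) := by
  set n₁ : ℕ := D + D + T₁ with hn₁
  set A : ℕ := (D + D + T₀) * δ₀ + 1 with hA
  have hM1 : (1 : ℝ) ≤ M := by exact_mod_cast (show 1 ≤ M by omega)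
  have hM0 : (0 : ℝ) ≤ M := by linarith
  have hM2 : (2 : ℝ) ≤ M := by exact_mod_cast (show 2 ≤ M by omega)
  have hΘ0 : 0 ≤ Θ := by linarith
  have hP : ∀ k : ℕ, 0 ≤ (M : ℝ) ^ k := fun k => pow_nonneg hM0 k
  have hP1 : ∀ k : ℕ, 1 ≤ (M : ℝ) ^ k := fun k => one_le_pow₀ hM1
  have hn₁le : n₁ ≤ M := by omega
  have hAle : A ≤ M := hAM
  have hAr : ((A : ℕ) : ℝ) ≤ M := by exact_mod_cast hAle
  have hT₁r : (T₁ : ℝ) ≤ M := by exact_mod_cast hT₁M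
  -- the factors
  have hbθn : bθ ^ n₁ ≤ (M : ℝ) ^ M := pow_le_pow_of_le hbθ0 hbθM hM1 hn₁le
  have hΘA : Θ ^ A ≤ (M : ℝ) ^ M := pow_le_pow_of_le hΘ0 hΘM hM1 hAle
  have hPb : ((A : ℕ) : ℝ) * Cf * Θ ^ A ≤ (M : ℝ) ^ (4 * M + 7) := by
    calc _ ≤ (M : ℝ) ^ 1 * (M : ℝ) ^ (3 * M + 6) * (M : ℝ) ^ M :=
          mul_le_mul (mul_le_mul (by rw [pow_one]; exact hAr) hCf hCf0 (hP _)) hΘA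
            (pow_nonneg hΘ0 _) (mul_nonneg (hP _) (hP _))
      _ = (M : ℝ) ^ (4 * M + 7) := by simp only [← pow_add]; congr 1; ring
  have hfact : ((T₁.factorial : ℕ) : ℝ) ≤ (M : ℝ) ^ M := factorial_le_pow_of_le hT₁M (by omega)
  have hexp : Real.exp (C_A * ((D + 1) * (X : ℝ) ^ 2 + T₁)) * Real.exp (-(T₀ * X ^ 2 : ℝ)) ≤
      Real.exp ((M : ℝ) ^ 2) * Real.exp (C_A * ((D + 1) * (X : ℝ) ^ 2) - T₀ * (X : ℝ) ^ 2) := by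
    rw [← Real.exp_add, ← Real.exp_add]
    apply Real.exp_le_exp.mpr
    have : C_A * (T₁ : ℝ) ≤ M * M := mul_le_mul hCAM hT₁r (by positivity) hM0
    nlinarith
  have hR : HY * Θ ^ (A + n₁ * δ₀) ≤ (M : ℝ) ^ (8 * M + 12) := by
    calc _ ≤ (M : ℝ) ^ (6 * M + 12) * (M : ℝ) ^ (2 * M) :=
          mul_le_mul hHY (pow_le_pow_of_le hΘ0 hΘM hM1 (by omega)) (pow_nonneg hΘ0 _) (hP _)
      _ = (M : ℝ) ^ (8 * M + 12) := by rw [← pow_add]; congr 1; ring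
  have hR0 : 0 ≤ HY * Θ ^ (A + n₁ * δ₀) := mul_nonneg hHY0 (pow_nonneg hΘ0 _)
  have hcof : (d : ℝ) * (1 + d * (HY * Θ ^ (A + n₁ * δ₀))) ^ d ≤ (M : ℝ) ^ (1 + (8 * M + 14) * d) := by
    have h1 : 1 + (d : ℝ) * (HY * Θ ^ (A + n₁ * δ₀)) ≤ (M : ℝ) ^ (8 * M + 14) := by
      calc 1 + (d : ℝ) * (HY * Θ ^ (A + n₁ * δ₀)) ≤ 1 + (M : ℝ) * (M : ℝ) ^ (8 * M + 12) := by
            have := mul_le_mul hdM hR hR0 hM0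
            linarith
        _ = 1 + (M : ℝ) ^ (8 * M + 13) := by rw [← pow_succ']
        _ ≤ (M : ℝ) ^ (8 * M + 13) + (M : ℝ) ^ (8 * M + 13) := by linarith [hP1 (8 * M + 13)]
        _ = 2 * (M : ℝ) ^ (8 * M + 13) := by ring
        _ ≤ (M : ℝ) * (M : ℝ) ^ (8 * M + 13) := mul_le_mul_of_nonneg_right hM2 (hP _)
        _ = (M : ℝ) ^ (8 * M + 14) := by rw [← pow_succ']
    have h0 : 0 ≤ 1 + (d : ℝ) * (HY * Θ ^ (A + n₁ * δ₀)) := by positivity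
    calc (d : ℝ) * (1 + d * (HY * Θ ^ (A + n₁ * δ₀))) ^ d ≤
          (M : ℝ) ^ 1 * ((M : ℝ) ^ (8 * M + 14)) ^ d :=
          mul_le_mul (by rw [pow_one]; exact hdM) (pow_le_pow_left₀ h0 h1 d)
            (pow_nonneg h0 _) (hP _)
      _ = (M : ℝ) ^ (1 + (8 * M + 14) * d) := by rw [← pow_mul, ← pow_add]
  -- the exponent count `6M + 8 + (8M+14)d ≤ 16 M d`
  have hexpo : M + (4 * M + 7) + M + (1 + (8 * M + 14) * d) ≤ 16 * M * d := by
    have h1 : 14 * d ≤ M * d := Nat.mul_le_mul_right d hM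
    have h2 : 7 * M ≤ 7 * M * d := Nat.le_mul_of_pos_right _ (by omega)
    nlinarith
  -- combine
  have hinner : ((A : ℕ) : ℝ) * Cf * Θ ^ A * (T₁.factorial : ℝ) *
      Real.exp (C_A * ((D + 1) * (X : ℝ) ^ 2 + T₁)) * Real.exp (-(T₀ * X ^ 2 : ℝ)) ≤
      (M : ℝ) ^ (4 * M + 7) * (M : ℝ) ^ M *
        (Real.exp ((M : ℝ) ^ 2) * Real.exp (C_A * ((D + 1) * (X : ℝ) ^ 2) - T₀ * (X : ℝ) ^ 2)) := by
    have hPT : ((A : ℕ) : ℝ) * Cf * Θ ^ A * (T₁.factorial : ℝ) ≤ (M : ℝ) ^ (4 * M + 7) * (M : ℝ) ^ M :=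
      mul_le_mul hPb (by exact_mod_cast hfact) (by positivity) (hP _)
    have h0 : 0 ≤ ((A : ℕ) : ℝ) * Cf * Θ ^ A * (T₁.factorial : ℝ) := by positivity
    calc _ = (((A : ℕ) : ℝ) * Cf * Θ ^ A * (T₁.factorial : ℝ)) *
          (Real.exp (C_A * ((D + 1) * (X : ℝ) ^ 2 + T₁)) * Real.exp (-(T₀ * X ^ 2 : ℝ))) := by ring
      _ ≤ _ := mul_le_mul hPT hexp (by positivity) (mul_nonneg (hP _) (hP _))
  have h0inner : 0 ≤ ((A : ℕ) : ℝ) * Cf * Θ ^ A * (T₁.factorial : ℝ) *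
      Real.exp (C_A * ((D + 1) * (X : ℝ) ^ 2 + T₁)) * Real.exp (-(T₀ * X ^ 2 : ℝ)) := by positivity
  have hcof0 : 0 ≤ (d : ℝ) * (1 + d * (HY * Θ ^ (A + n₁ * δ₀))) ^ d := by positivity
  calc _ ≤ (M : ℝ) ^ M * ((M : ℝ) ^ (4 * M + 7) * (M : ℝ) ^ M *
        (Real.exp ((M : ℝ) ^ 2) * Real.exp (C_A * ((D + 1) * (X : ℝ) ^ 2) - T₀ * (X : ℝ) ^ 2))) *
        (M : ℝ) ^ (1 + (8 * M + 14) * d) :=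
        mul_le_mul (mul_le_mul hbθn hinner h0inner (hP _)) hcof hcof0
          (mul_nonneg (hP _) (by positivity))
    _ = (M : ℝ) ^ (M + (4 * M + 7) + M + (1 + (8 * M + 14) * d)) *
          Real.exp ((M : ℝ) ^ 2) * Real.exp (C_A * ((D + 1) * (X : ℝ) ^ 2) - T₀ * (X : ℝ) ^ 2) := by
        simp only [pow_add]; ring
    _ ≤ (M : ℝ) ^ (16 * M * d) * Real.exp ((M : ℝ) ^ 2) *
          Real.exp (C_A * ((D + 1) * (X : ℝ) ^ 2) - T₀ * (X : ℝ) ^ 2) := by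
        have := pow_le_pow_right₀ hM1 hexpo
        have h1 : 0 ≤ Real.exp ((M : ℝ) ^ 2) := (Real.exp_pos _).le
        have h2 : 0 ≤ Real.exp (C_A * ((D + 1) * (X : ℝ) ^ 2) - T₀ * (X : ℝ) ^ 2) := (Real.exp_pos _).le
        exact mul_le_mul_of_nonneg_right (mul_le_mul_of_nonneg_right this h1) h2


/-! ### The construction at level `D`: structural form -/

variable (L : PeriodPair) {θ : ℂ}

/-- **Level `D`, structural form** (Chudnovsky 1984, Ch. 7, §2, pp. 305–307 and §3,
pp. 309–310). Given the analytic constant `C_A` (Schwarz), the zero-estimate constant `C_Z`,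
degree/height bounds `δ₀, H₀` for the envelope, and parameters `T₀, X, T₁` satisfying the Siegel
count and the zero-estimate inequality, there is `Q ∈ ℤ[T]` (the norm of
`ξ = F_p^{(j₀)}(s_{m₀}) ≠ 0`) with `Q(θ) ≠ 0` and explicit bounds for `deg Q`, `zl1 Q` and
`|Q(θ)|`. [cite: Chudnovsky1984, Ch. 7 Thm 3.1 p. 309] -/
theorem level_struct (hθ : Transcendental ℚ θ) (E : Envelope θ (xv L))
    {C_A : ℝ} (hC_A : 0 ≤ C_A)
    (hAN : ∀ (D X T : ℕ), 1 ≤ X → ∀ p : Fin (D + 1) × Fin (D + 1) → ℂ,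
      (∀ m < X, ∀ j < T, iteratedDeriv j (F L D p) (s L m) = 0) → ∀ m₀ < X, ∀ j : ℕ,
        ‖iteratedDeriv j (F L D p) (s L m₀)‖ ≤
          ‖p‖ * j.factorial * Real.exp (C_A * ((D + 1) * X ^ 2 + j)) *
            Real.exp (-(T * X ^ 2 : ℝ)))
    {C_Z : ℝ}
    (hZE : ∀ (D X T : ℕ), 1 ≤ X → ∀ p : Fin (D + 1) × Fin (D + 1) → ℂ, p ≠ 0 →
      (∀ m < X, ∀ j < T, iteratedDeriv j (F L D p) (s L m) = 0) →
      (T : ℝ) * X ^ 2 ≤ C_Z * (D + 1) * ((X : ℝ) + D) ^ 2)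
    {δ₀ : ℕ} (hNδ : ∀ l i j, (E.N l i j).natDegree ≤ δ₀) (hbδ : E.b.natDegree ≤ δ₀)
    {H₀ : ℝ} (hH₀ : 1 ≤ H₀) (hNH : ∀ l i j, zl1 (E.N l i j) ≤ H₀) (hbH : zl1 E.b ≤ H₀)
    (D T₀ X T₁ : ℕ) (hT₀ : 1 ≤ T₀) (hX : 1 ≤ X) (hcount : 8 * (T₀ * X * E.d ^ 2) ≤ (D + 1) ^ 2)
    (hT₁ : C_Z * (D + 1) * ((X : ℝ) + D) ^ 2 < (T₁ : ℝ) * X ^ 2) :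
    ∃ Q : ℤ[X], Polynomial.aeval θ Q ≠ 0 ∧
      Q.natDegree ≤ E.d * (((D + D + T₀) * δ₀ + 1) + (D + D + T₁) * δ₀) ∧
      zl1 Q ≤ ((E.d : ℝ) *
        (((D : ℝ) + 1) ^ 2 *
          ((((D + D + T₀) * δ₀ + 1 : ℕ) : ℝ) *
            (((D : ℝ) + 1) ^ 2 * (((D + D + T₀) * δ₀ + 1 : ℕ) : ℝ) *
              ((7 * ((D : ℝ) + D + T₀)) ^ (D + D + T₀) * (X : ℝ) ^ (D + D + T₀) *
                ((E.d : ℝ) ^ 3 * (E.d * H₀) ^ (D + D + T₀))))) *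
          ((7 * ((D + D + T₁ : ℕ) : ℝ)) ^ (D + D + T₁) * (X : ℝ) ^ (D + D + T₁)) *
          ((E.d : ℝ) ^ 3 * (E.d * H₀) ^ (D + D + T₁)))) ^ E.d ∧
      ‖Polynomial.aeval θ Q‖ ≤
        ‖Polynomial.aeval θ E.b‖ ^ (D + D + T₁) *
          (((((D + D + T₀) * δ₀ + 1 : ℕ) : ℝ) *
              (((D : ℝ) + 1) ^ 2 * (((D + D + T₀) * δ₀ + 1 : ℕ) : ℝ) *
                ((7 * ((D : ℝ) + D + T₀)) ^ (D + D + T₀) * (X : ℝ) ^ (D + D + T₀) *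
                  ((E.d : ℝ) ^ 3 * (E.d * H₀) ^ (D + D + T₀)))) *
              max 1 ‖θ‖ ^ ((D + D + T₀) * δ₀ + 1)) *
            T₁.factorial * Real.exp (C_A * ((D + 1) * X ^ 2 + T₁)) *
            Real.exp (-(T₀ * X ^ 2 : ℝ))) *
          (E.d * (1 + E.d *
            ((((D : ℝ) + 1) ^ 2 *
              ((((D + D + T₀) * δ₀ + 1 : ℕ) : ℝ) *
                (((D : ℝ) + 1) ^ 2 * (((D + D + T₀) * δ₀ + 1 : ℕ) : ℝ) *
                  ((7 * ((D : ℝ) + D + T₀)) ^ (D + D + T₀) * (X : ℝ) ^ (D + D + T₀) *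
                    ((E.d : ℝ) ^ 3 * (E.d * H₀) ^ (D + D + T₀))))) *
              ((7 * ((D + D + T₁ : ℕ) : ℝ)) ^ (D + D + T₁) * (X : ℝ) ^ (D + D + T₁)) *
              ((E.d : ℝ) ^ 3 * (E.d * H₀) ^ (D + D + T₁))) *
              max 1 ‖θ‖ ^ (((D + D + T₀) * δ₀ + 1) + (D + D + T₁) * δ₀))) ^ E.d) := by
  -- abbreviations
  set n₀ : ℕ := D + D + T₀ with hn₀
  set A : ℕ := n₀ * δ₀ + 1 with hA
  set n₁ : ℕ := D + D + T₁ with hn₁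
  set B : ℝ := (7 * ((D : ℝ) + D + T₀)) ^ n₀ * (X : ℝ) ^ n₀ *
    ((E.d : ℝ) ^ 3 * (E.d * H₀) ^ n₀) with hB
  set Cf : ℝ := ((D : ℝ) + 1) ^ 2 * (A : ℝ) * B with hCf
  set Θ : ℝ := max 1 ‖θ‖ with hΘ
  set HY : ℝ := ((D : ℝ) + 1) ^ 2 * (A * Cf) * ((7 * (n₁ : ℝ)) ^ n₁ * (X : ℝ) ^ n₁) *
    ((E.d : ℝ) ^ 3 * (E.d * H₀) ^ n₁) with hHY
  have hCf0 : 0 ≤ Cf := by positivity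
  have hHY0 : 0 ≤ HY := by positivity
  -- Step 1: Siegel
  obtain ⟨pp, hpp0, hppdeg, hppB, hppeq⟩ :=
    siegel_step L E hH₀ hNδ hbδ hNH hbH D T₀ X hT₀ hX hcount
  set p : Fin (D + 1) × Fin (D + 1) → ℂ := fun l => Polynomial.aeval θ (pp l) with hp
  have hp0 : p ≠ 0 := coeffFamily_ne_zero hθ hpp0
  have hzeros : ∀ m < X, ∀ j < T₀, iteratedDeriv j (F L D p) (s L m) = 0 := by
    intro m hm j hj
    exact iteratedDeriv_eq_zero L E pp (by omega) (hppeq j hj m hm)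
  -- Step 2: the zero estimate
  obtain ⟨j₀, hj₀, m₀, hm₀, hξ⟩ := exists_iteratedDeriv_ne_zero L hZE hX hp0 hT₁
  -- Step 3: the upper bound for `ξ`
  have hpn : ‖p‖ ≤ A * Cf * Θ ^ A := norm_coeffFamily_le hCf0 hppdeg hppB
  have hξle : ‖iteratedDeriv j₀ (F L D p) (s L m₀)‖ ≤
      (A * Cf * Θ ^ A) * T₁.factorial * Real.exp (C_A * ((D + 1) * X ^ 2 + T₁)) *
        Real.exp (-(T₀ * X ^ 2 : ℝ)) := by
    refine (hAN D X T₀ hX p hzeros m₀ hm₀ j₀).trans ?_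
    have h1 : (j₀.factorial : ℝ) ≤ T₁.factorial := by
      exact_mod_cast Nat.factorial_le hj₀.le
    have hjT : (j₀ : ℝ) ≤ T₁ := by exact_mod_cast hj₀.le
    have h2 : Real.exp (C_A * ((D + 1) * X ^ 2 + j₀)) ≤
        Real.exp (C_A * ((D + 1) * X ^ 2 + T₁)) :=
      Real.exp_le_exp.mpr (mul_le_mul_of_nonneg_left (by linarith) hC_A)
    have hACf : 0 ≤ (A : ℝ) * Cf * Θ ^ A := by positivity
    exact mul_le_mul_of_nonneg_right (mul_le_mul (mul_le_mul hpn h1 (by positivity) hACf) h2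
      (by positivity) (by positivity)) (by positivity)
  -- Step 4: the norm
  set Y := homEval E.N E.b n₁ (∑ l : Fin _ × Fin _, MvPolynomial.C (pp l) *
        MvPolynomial.map (Polynomial.C : ℤ →+* Polynomial ℤ) (V j₀ m₀ l.1 l.2)) with hYdef
  have hn : D + D + j₀ ≤ n₁ := by omega
  have hn1 : 1 ≤ n₁ := by omega
  have hYentry : ∀ i j, zl1 (Y i j) ≤ HY := fun i j =>
    zl1_entry_le L E pp j₀ m₀ n₁ hH₀ hCf0 hNH hbH hppdeg hppB hn hn1 hm₀ i j
  have hYdeg : ∀ i j, (Y i j).natDegree ≤ A + n₁ * δ₀ := fun i j =>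
    natDegree_homEval_entry_le hNδ hbδ
      (fun α hα => (degree_le_of_mem_support_Pmix pp j₀ m₀ hα).trans hn)
      (natDegree_coeff_Pmix_le pp hppdeg j₀ m₀) i j
  refine ⟨Y.det, aeval_det_ne_zero L E pp j₀ m₀ n₁ hn hξ,
    natDegree_det_le L E pp j₀ m₀ n₁ hNδ hbδ hppdeg hn,
    zl1_det_le_of_entry hHY0 hYentry, ?_⟩
  refine (norm_aeval_det_le L E pp j₀ m₀ n₁ hHY0 hYentry hYdeg hn).trans ?_
  refine mul_le_mul_of_nonneg_right ?_ (by positivity)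
  rw [norm_mul, norm_pow]
  exact mul_le_mul_of_nonneg_left hξle (by positivity)

/-! ### The construction at level `D`: the three numerical outputs -/

set_option maxHeartbeats 800000 in
-- the bookkeeping below is long but elementary; the default heartbeat budget is too small
/-- **Level `D`** (Chudnovsky 1984, Ch. 7, Thm 3.1, pp. 309–310: "`P_{L₂}(x) ∈ ℤ[x]`,
`P_{L₂}(θ) ≠ 0`, `t(P_{L₂}) ≤ γ₁₃ L₂ log L₂`, `log |P_{L₂}(θ)| < -γ₁₄ L₂³`"). For a
transcendental `θ` with an envelope for `(κ, g₂/2, c, e₁)` there are constants such that for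
every `D ≥ D₀` some nonzero `Q ∈ ℤ[T]` has `deg Q ≤ K_deg (D+2)`,
`log ‖Q‖₁ ≤ K_type (D+2)^{3/2}` and `log |Q(θ)| ≤ -γ (D+2)³`.
[cite: Chudnovsky1984, Ch. 7 Thm 3.1 p. 309] -/
theorem exists_level_bounds (hθ : Transcendental ℚ θ) (E : Envelope θ (xv L)) :
    ∃ (Kdeg Ktype γ : ℝ) (D₀ : ℕ), 0 < Kdeg ∧ 0 < Ktype ∧ 0 < γ ∧ ∀ D : ℕ, D₀ ≤ D →
      ∃ Q : ℤ[X], Q ≠ 0 ∧ (Q.natDegree : ℝ) ≤ Kdeg * ((D : ℝ) + 2) ∧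
        Real.log (zl1 Q) ≤ Ktype * (((D : ℝ) + 2) * Real.sqrt ((D : ℝ) + 2)) ∧
        Real.log ‖Polynomial.aeval θ Q‖ ≤ -(γ * ((D : ℝ) + 2) ^ 3) := by
  classical
  obtain ⟨C_A, hC_A, hAN⟩ := norm_iteratedDeriv_F_le_of_zeros L
  obtain ⟨C_Z, hC_Z, hZE⟩ := zero_estimate L
  -- envelope data: degree and height bounds
  have hd : 1 ≤ E.d := E.d_pos
  have hd' : (1 : ℝ) ≤ E.d := by exact_mod_cast hd
  obtain ⟨δ₀, hNδ, hbδ⟩ : ∃ δ₀ : ℕ, (∀ l i j, (E.N l i j).natDegree ≤ δ₀) ∧ E.b.natDegree ≤ δ₀ := by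
    refine ⟨E.b.natDegree + ∑ t : Fin 4 × Fin E.d × Fin E.d, (E.N t.1 t.2.1 t.2.2).natDegree,
      fun l i j => ?_, Nat.le_add_right _ _⟩
    have := Finset.single_le_sum (f := fun t : Fin 4 × Fin E.d × Fin E.d =>
      (E.N t.1 t.2.1 t.2.2).natDegree) (fun t _ => Nat.zero_le _) (Finset.mem_univ (l, i, j))
    simp only at this
    omega
  obtain ⟨H₀, hH₀1, hNH, hbH⟩ : ∃ H₀ : ℝ, 1 ≤ H₀ ∧ (∀ l i j, zl1 (E.N l i j) ≤ H₀) ∧ zl1 E.b ≤ H₀ := by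
    have hsum0 : 0 ≤ ∑ t : Fin 4 × Fin E.d × Fin E.d, zl1 (E.N t.1 t.2.1 t.2.2) :=
      Finset.sum_nonneg fun t _ => apply_nonneg _ _
    have hb0 : 0 ≤ zl1 E.b := apply_nonneg _ _
    refine ⟨1 + zl1 E.b + ∑ t : Fin 4 × Fin E.d × Fin E.d, zl1 (E.N t.1 t.2.1 t.2.2),
      by linarith, fun l i j => ?_, by linarith⟩
    have := Finset.single_le_sum (f := fun t : Fin 4 × Fin E.d × Fin E.d =>
      zl1 (E.N t.1 t.2.1 t.2.2)) (fun t _ => apply_nonneg _ _) (Finset.mem_univ (l, i, j))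
    simp only at this
    linarith
  obtain ⟨Θ, hΘeq⟩ : ∃ Θ : ℝ, max 1 ‖θ‖ = Θ := ⟨_, rfl⟩
  have hΘ1 : 1 ≤ Θ := by rw [← hΘeq]; exact le_max_left _ _
  obtain ⟨bθ, hbθeq⟩ : ∃ bθ : ℝ, max 1 ‖Polynomial.aeval θ E.b‖ = bθ := ⟨_, rfl⟩
  have hbθ1 : 1 ≤ bθ := by rw [← hbθeq]; exact le_max_left _ _
  have hbθle1 : ‖Polynomial.aeval θ E.b‖ ≤ bθ := by rw [← hbθeq]; exact le_max_right _ _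
  -- parameters
  obtain ⟨γ₁, hγ₁⟩ : ∃ γ₁ : ℝ, γ₁ = 4 * C_A + 2 := ⟨_, rfl⟩
  have hγ₁1 : 1 ≤ γ₁ := by rw [hγ₁]; linarith
  obtain ⟨γ₂, hγ₂⟩ : ∃ γ₂ : ℝ, γ₂ = 1 / (16 * (E.d : ℝ) ^ 2 * (γ₁ + 1)) := ⟨_, rfl⟩
  have hγ₂0 : 0 < γ₂ := by rw [hγ₂]; positivity
  have hγ₂le : γ₂ * (16 * (E.d : ℝ) ^ 2 * (γ₁ + 1)) ≤ 1 := by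
    rw [hγ₂, one_div, inv_mul_cancel₀ (by positivity)]
  have hγ₂half : 2 * γ₂ ≤ 1 := by
    have h16 : (16 : ℝ) ≤ 16 * (E.d : ℝ) ^ 2 * (γ₁ + 1) := by nlinarith
    rw [hγ₂, mul_one_div, div_le_one (by positivity)]
    linarith
  obtain ⟨cZ, hcZ⟩ : ∃ cZ : ℝ, cZ = C_Z * (1 + 1 / γ₂) ^ 2 + 3 := ⟨_, rfl⟩
  have hcZ3 : 3 ≤ cZ := by rw [hcZ]; nlinarith [sq_nonneg (1 + 1 / γ₂)]
  obtain ⟨Ωn, hΩ₀le⟩ : ∃ Ωn : ℕ,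
      14 + 7 * (γ₁ + 3) * (δ₀ + 1) + 7 * cZ * (δ₀ + 1) + E.d * H₀ + Θ + bθ + C_A ≤ (Ωn : ℝ) :=
    ⟨_, Nat.le_ceil _⟩
  obtain ⟨hΩ14, hΩγ₁, hΩcZ, hΩ7γ₁, hΩ7cZ, hΩAδ, hΩcZδ, hΩdH, hΩΘ, hΩbθ, hΩCA⟩ :=
    Omega_facts (γ₁ := γ₁) (cZ := cZ) (dH₀ := (E.d : ℝ) * H₀) (Θ := Θ) (bθ := bθ) (C_A := C_A)
      (Ω := (Ωn : ℝ)) (δ₀ := δ₀) hγ₁1 hcZ3 (by positivity) (by linarith) (by linarith) hC_A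
      hΩ₀le
  have hΩn14 : 14 ≤ Ωn := by exact_mod_cast hΩ14
  have hΩ2 : (2 : ℝ) ≤ Ωn := by linarith
  -- the threshold `D₀`
  obtain ⟨sthr, hsthr⟩ : ∃ sthr : ℝ,
      sthr = 8 * (32 * (Ωn : ℝ) ^ 2 * E.d + (Ωn : ℝ) ^ 2) / γ₂ ^ 2 := ⟨_, rfl⟩
  have hsthr0 : 0 ≤ sthr := by rw [hsthr]; positivity
  refine ⟨2 * E.d * Ωn, 14 * (Ωn : ℝ) ^ 2 * E.d, γ₂ ^ 2 / 8, ⌈2 / γ₂⌉₊ + ⌈sthr ^ 2⌉₊,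
    by positivity, by positivity, by positivity, ?_⟩
  intro D hD
  have hD0 : (0 : ℝ) ≤ D := Nat.cast_nonneg D
  -- `s = √(D+2)`
  obtain ⟨sD, hsD⟩ : ∃ sD : ℝ, sD = Real.sqrt ((D : ℝ) + 2) := ⟨_, rfl⟩
  have hsD2 : sD ^ 2 = (D : ℝ) + 2 := by rw [hsD, Real.sq_sqrt (by positivity)]
  have hsD1 : 1 ≤ sD := by
    rw [hsD, Real.le_sqrt (by norm_num) (by positivity)]; linarith
  have hsD0 : 0 ≤ sD := by linarith
  -- consequences of `D ≥ D₀`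
  have hDγ₂ : 1 ≤ γ₂ * (D + 1) := by
    have h1 : (⌈2 / γ₂⌉₊ : ℝ) ≤ D := by
      have : ⌈2 / γ₂⌉₊ ≤ D := le_trans (Nat.le_add_right _ _) hD
      exact_mod_cast this
    have h2 : 2 / γ₂ ≤ D := (Nat.le_ceil _).trans h1
    rw [div_le_iff₀ hγ₂0] at h2
    have h3 : γ₂ * (D + 1) = D * γ₂ + γ₂ := by ring
    rw [h3]; linarith
  have hsthr_le : sthr ≤ sD := by
    have h1 : (⌈sthr ^ 2⌉₊ : ℝ) ≤ D := by
      have : ⌈sthr ^ 2⌉₊ ≤ D := le_trans (Nat.le_add_left _ _) hD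
      exact_mod_cast this
    have h2 : sthr ^ 2 ≤ (D : ℝ) + 2 := by linarith [Nat.le_ceil (sthr ^ 2)]
    rw [hsD, Real.le_sqrt hsthr0 (by positivity)]
    exact h2
  -- the parameters at level `D`
  obtain ⟨h1T₀, h1X, hT₀ge, hT₀le, hXge, hXle, hcount⟩ :=
    params_ok (D := D) hγ₁1 hγ₂0 hd hγ₂le hDγ₂
  obtain ⟨T₀, hT₀def⟩ : ∃ T₀ : ℕ, ⌈γ₁ * (D + 1)⌉₊ = T₀ := ⟨_, rfl⟩
  obtain ⟨X, hXdef⟩ : ∃ X : ℕ, ⌈γ₂ * (D + 1)⌉₊ = X := ⟨_, rfl⟩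
  rw [hT₀def] at h1T₀ hT₀ge hT₀le hcount
  rw [hXdef] at h1X hXge hXle hcount
  have hT₁ := T₁_ok (D := D) hC_Z hγ₂0 h1X hXge
  have hT₁le : ((⌈C_Z * (D + 1) * (1 + 1 / γ₂) ^ 2⌉₊ + 1 : ℕ) : ℝ) ≤
      C_Z * (D + 1) * (1 + 1 / γ₂) ^ 2 + 2 := by
    push_cast
    linarith [Nat.ceil_lt_add_one (show 0 ≤ C_Z * (D + 1) * (1 + 1 / γ₂) ^ 2 by positivity)]
  obtain ⟨T₁, hT₁def⟩ : ∃ T₁ : ℕ, ⌈C_Z * (D + 1) * (1 + 1 / γ₂) ^ 2⌉₊ + 1 = T₁ := ⟨_, rfl⟩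
  rw [hT₁def] at hT₁ hT₁le
  -- the structural construction
  obtain ⟨Q, hQθ, hQdeg, hQzl1, hQval⟩ :=
    level_struct L hθ E hC_A hAN hZE hNδ hbδ hH₀1 hNH hbH D T₀ X T₁ h1T₀ h1X hcount hT₁
  rw [hΘeq] at hQval
  have hQ0 : Q ≠ 0 := by
    rintro rfl
    exact hQθ (by simp)
  -- the currency `M = Ωn (D+2)`
  obtain ⟨M, hM⟩ : ∃ M : ℕ, M = Ωn * (D + 2) := ⟨_, rfl⟩
  have hMr : (M : ℝ) = Ωn * ((D : ℝ) + 2) := by rw [hM]; push_cast; ring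
  have hMs : (M : ℝ) = Ωn * sD ^ 2 := by rw [hMr, hsD2]
  have hΩnM : Ωn ≤ M := by rw [hM]; exact Nat.le_mul_of_pos_right _ (by omega)
  have hM14 : 14 ≤ M := hΩn14.trans hΩnM
  have hM1 : 1 ≤ M := by omega
  have hM1r : (1 : ℝ) ≤ M := by exact_mod_cast hM1
  have hDM : D + 2 ≤ M := by
    rw [hM]; exact Nat.le_mul_of_pos_left _ (by omega)
  have hD2r : (0 : ℝ) < (D : ℝ) + 2 := by positivity
  -- `q ≤ M` for the basic quantities (via real inequalities `q ≤ c (D+2)`, `c ≤ Ωn`)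
  have hle_M : ∀ {q c : ℝ}, q ≤ c * ((D : ℝ) + 2) → c ≤ Ωn → q ≤ M := by
    intro q c hq hc
    rw [hMr]
    exact hq.trans (mul_le_mul_of_nonneg_right hc hD2r.le)
  obtain ⟨hXb, hT₁b, hn₀b, hn₁b, hAb, hn₁δb⟩ :=
    params_M_bounds (T₀ := (T₀ : ℝ)) (X := (X : ℝ)) (T₁ := (T₁ : ℝ)) (δ₀ := (δ₀ : ℝ))
      (g := (1 + 1 / γ₂) ^ 2) hD0 hγ₁1 hγ₂half hC_Z (by positivity) (Nat.cast_nonneg δ₀)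
      hT₀le hXle hT₁le
  have hcZg : C_Z * (1 + 1 / γ₂) ^ 2 + 3 = cZ := hcZ.symm
  have hXM : X ≤ M := by
    have : (X : ℝ) ≤ M := hle_M hXb (by linarith)
    exact_mod_cast this
  have hT₁M : T₁ ≤ M := by
    have : (T₁ : ℝ) ≤ M := hle_M hT₁b (by linarith)
    exact_mod_cast this
  have hn₀M : 7 * (D + D + T₀) ≤ M := by
    have : ((7 * (D + D + T₀) : ℕ) : ℝ) ≤ M := by
      push_cast
      exact hle_M hn₀b hΩ7γ₁
    exact_mod_cast this
  have hn₁M : 7 * (D + D + T₁) ≤ M := by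
    have : ((7 * (D + D + T₁) : ℕ) : ℝ) ≤ M := by
      push_cast
      exact hle_M hn₁b (by rw [hcZg]; exact hΩ7cZ)
    exact_mod_cast this
  have hAM : (D + D + T₀) * δ₀ + 1 ≤ M := by
    have : (((D + D + T₀) * δ₀ + 1 : ℕ) : ℝ) ≤ M := by
      push_cast
      exact hle_M hAb hΩAδ
    exact_mod_cast this
  have hn₁δM : (D + D + T₁) * δ₀ ≤ M := by
    have : (((D + D + T₁) * δ₀ : ℕ) : ℝ) ≤ M := by
      push_cast
      exact hle_M hn₁δb (by rw [hcZg]; exact hΩcZδ)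
    exact_mod_cast this
  have hD21 : (1 : ℝ) ≤ (D : ℝ) + 2 := by linarith
  have hdM : (E.d : ℝ) * H₀ ≤ M :=
    hle_M (le_mul_of_one_le_right (by positivity) hD21) hΩdH
  have hdM' : (E.d : ℝ) ≤ M := le_trans (le_mul_of_one_le_right (by positivity) hH₀1) hdM
  have hΘM : Θ ≤ M := hle_M (le_mul_of_one_le_right (by linarith) hD21) hΩΘ
  have hbθM : bθ ≤ M := hle_M (le_mul_of_one_le_right (by linarith) hD21) hΩbθ
  have hCAM : C_A ≤ M := hle_M (le_mul_of_one_le_right hC_A hD21) hΩCA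
  -- the currency bounds
  have hB := currency_B (D := D) (T₀ := T₀) hd hH₀1 hM1 hXM hn₀M hdM
  obtain ⟨B, hBeq⟩ : ∃ B : ℝ, (7 * ((D : ℝ) + D + T₀)) ^ (D + D + T₀) * (X : ℝ) ^ (D + D + T₀) *
      ((E.d : ℝ) ^ 3 * (E.d * H₀) ^ (D + D + T₀)) = B := ⟨_, rfl⟩
  have hB0 : 0 ≤ B := by rw [← hBeq]; positivity
  rw [hBeq] at hB hQzl1 hQval
  have hCf := currency_Cf (D := D) (T₀ := T₀) (δ₀ := δ₀) hM1 hDM hAM hB0 hB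
  obtain ⟨Cf, hCfeq⟩ : ∃ Cf : ℝ,
      ((D : ℝ) + 1) ^ 2 * (((D + D + T₀) * δ₀ + 1 : ℕ) : ℝ) * B = Cf := ⟨_, rfl⟩
  have hCf0 : 0 ≤ Cf := by rw [← hCfeq]; positivity
  rw [hCfeq] at hCf hQzl1 hQval
  have hHY := currency_HY (D := D) (T₀ := T₀) (T₁ := T₁) (X := X) (δ₀ := δ₀) hd hH₀1 hM1 hDM
    hXM hn₁M hAM hdM hCf0 hCf
  obtain ⟨HY, hHYeq⟩ : ∃ HY : ℝ, ((D : ℝ) + 1) ^ 2 * ((((D + D + T₀) * δ₀ + 1 : ℕ) : ℝ) * Cf) *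
      ((7 * ((D + D + T₁ : ℕ) : ℝ)) ^ (D + D + T₁) * (X : ℝ) ^ (D + D + T₁)) *
      ((E.d : ℝ) ^ 3 * (E.d * H₀) ^ (D + D + T₁)) = HY := ⟨_, rfl⟩
  have hHY0 : 0 ≤ HY := by rw [← hHYeq]; positivity
  rw [hHYeq] at hHY hQzl1 hQval
  have hzl1 := currency_zl1 hd (by omega) hdM' hHY0 hHY
  have hc3 := currency_c3 (D := D) (T₀ := T₀) (T₁ := T₁) (X := X) (δ₀ := δ₀) (C_A := C_A)
    hd hΘ1 (by linarith : (0 : ℝ) ≤ bθ) hM14 hT₁M hn₁M hAM hn₁δM hdM' hΘM hbθM hCAM hCf0 hCf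
    hHY0 hHY
  refine ⟨Q, hQ0, ?_, ?_, ?_⟩
  · -- degree
    have h1 : (Q.natDegree : ℝ) ≤
        ((E.d * (((D + D + T₀) * δ₀ + 1) + (D + D + T₁) * δ₀) : ℕ) : ℝ) := by
      exact_mod_cast hQdeg
    refine h1.trans ?_
    have h2 : ((D + D + T₀) * δ₀ + 1) + (D + D + T₁) * δ₀ ≤ 2 * M := by omega
    have h3 : ((E.d * (((D + D + T₀) * δ₀ + 1) + (D + D + T₁) * δ₀) : ℕ) : ℝ) ≤
        ((E.d * (2 * M) : ℕ) : ℝ) := by exact_mod_cast Nat.mul_le_mul_left _ h2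
    refine h3.trans (le_of_eq ?_)
    push_cast; rw [hMr]; ring
  · -- height
    have hzl1Q : 0 < zl1 Q :=
      lt_of_lt_of_le zero_lt_one
        ((Polynomial.one_le_supNorm_of_ne_zero hQ0).trans (supNorm_le_zl1 Q))
    have h1 : Real.log (zl1 Q) ≤ Real.log ((M : ℝ) ^ (7 * M * E.d)) :=
      Real.log_le_log hzl1Q (hQzl1.trans hzl1)
    refine h1.trans ?_
    rw [Real.log_pow]
    have hlogM : Real.log M ≤ 2 * Ωn * sD := by rw [hMs]; exact log_mul_sq_le hΩ2 hsD1
    calc ((7 * M * E.d : ℕ) : ℝ) * Real.log M ≤ ((7 * M * E.d : ℕ) : ℝ) * (2 * Ωn * sD) :=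
          mul_le_mul_of_nonneg_left hlogM (by positivity)
      _ = 14 * (Ωn : ℝ) ^ 2 * E.d * (((D : ℝ) + 2) * sD) := by
          push_cast; rw [hMs, ← hsD2]; ring
      _ = 14 * (Ωn : ℝ) ^ 2 * E.d * (((D : ℝ) + 2) * Real.sqrt ((D : ℝ) + 2)) := by rw [hsD]
  · -- the value at `θ`
    have hQθ0 : 0 < ‖Polynomial.aeval θ Q‖ := norm_pos_iff.mpr hQθ
    have hbθle : ‖Polynomial.aeval θ E.b‖ ^ (D + D + T₁) ≤ bθ ^ (D + D + T₁) :=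
      pow_le_pow_left₀ (norm_nonneg _) hbθle1 _
    have hval : ‖Polynomial.aeval θ Q‖ ≤ (M : ℝ) ^ (16 * M * E.d) * Real.exp ((M : ℝ) ^ 2) *
        Real.exp (C_A * ((D + 1) * (X : ℝ) ^ 2) - T₀ * (X : ℝ) ^ 2) := by
      refine hQval.trans (le_trans ?_ hc3)
      exact mul_le_mul_of_nonneg_right (mul_le_mul_of_nonneg_right hbθle (by positivity))
        (by positivity)
    have h1 := Real.log_le_log hQθ0 hval
    refine h1.trans ?_
    rw [Real.log_mul (by positivity) (by positivity), Real.log_mul (by positivity) (by positivity),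
      Real.log_exp, Real.log_exp, Real.log_pow]
    have hlogM : Real.log M ≤ 2 * Ωn * sD := by rw [hMs]; exact log_mul_sq_le hΩ2 hsD1
    have hmain : C_A * (((D : ℝ) + 1) * (X : ℝ) ^ 2) - (T₀ : ℝ) * (X : ℝ) ^ 2 ≤
        -(γ₂ ^ 2 * sD ^ 6 / 4) :=
      main_term hC_A hγ₂0 (by rw [← hγ₁]; exact hT₀ge) hXge (by rw [hsD2]; linarith)
    have hlogpow : ((16 * M * E.d : ℕ) : ℝ) * Real.log M ≤
        16 * (Ωn * sD ^ 2) * E.d * (2 * Ωn * sD) := by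
      calc ((16 * M * E.d : ℕ) : ℝ) * Real.log M ≤ ((16 * M * E.d : ℕ) : ℝ) * (2 * Ωn * sD) :=
            mul_le_mul_of_nonneg_left hlogM (by positivity)
        _ = 16 * (Ωn * sD ^ 2) * E.d * (2 * Ωn * sD) := by push_cast; rw [hMs]
    have hfin := final_ineq (Ω := (Ωn : ℝ)) (dd := (E.d : ℝ)) (by positivity) hγ₂0 hsD1
      (hsthr ▸ hsthr_le)
    have hcube : ((D : ℝ) + 2) ^ 3 = (sD ^ 2) ^ 3 := by rw [hsD2]
    have hbsq : ((M : ℝ)) ^ 2 = ((Ωn : ℝ) * sD ^ 2) ^ 2 := by rw [hMs]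
    rw [hcube]
    linarith [hlogpow, hfin, hmain, hbsq]

/-! ### Gelfond's criterion: the contradiction -/

/-- `(x+1)√(x+1) < 2 x √x` for `x ≥ 2` (the growth condition `σ_{N+1} < 2σ_N`). [folklore] -/
lemma sigma_ratio {x : ℝ} (hx : 2 ≤ x) : (x + 1) * Real.sqrt (x + 1) < 2 * (x * Real.sqrt x) := by
  have hx0 : 0 ≤ x := by linarith
  have ha : 0 ≤ (x + 1) * Real.sqrt (x + 1) := by positivity
  have hb : 0 ≤ 2 * (x * Real.sqrt x) := by positivity
  rw [← abs_of_nonneg ha, ← abs_of_nonneg hb, ← sq_lt_sq, mul_pow, mul_pow, mul_pow,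
    Real.sq_sqrt (by linarith), Real.sq_sqrt hx0]
  nlinarith

/-- The final gap in Gelfond's criterion: `γ t⁶ > 80 A B t⁵` once `t > 80AB/γ`. [folklore] -/
lemma gelfond_gap {A B γ t : ℝ} (hγ : 0 < γ) (ht : 0 < t) (h : 80 * (A * B) / γ < t) :
    -(γ * (t ^ 2) ^ 3) < -40 * 2 * (A * t ^ 2) * (B * (t ^ 2 * t)) := by
  rw [div_lt_iff₀ hγ] at h
  have ht5 : 0 < t ^ 5 := by positivity
  have := mul_lt_mul_of_pos_right h ht5
  nlinarith

/-- **The core contradiction** (Chudnovsky 1984, Ch. 7, Thm 3.1, p. 310: "Now we can apply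
Gelfond's lemma … and obtain the contradiction with `#K = 1`"): a transcendental `θ` over which
`κ, g₂/2, c, e₁` are algebraic (packaged as an `Envelope`) cannot exist, by Gelfond's criterion
applied to the polynomials `Q_D` of `exists_level_bounds` with `δ_N ≍ N`, `σ_N ≍ N^{3/2}`,
`a = 2`. [cite: Chudnovsky1984, Ch. 7 Thm 3.1 p. 309] -/
theorem core (hθ : Transcendental ℚ θ) (E : Envelope θ (xv L)) : False := by
  classical
  obtain ⟨Kdeg, Ktype, γ, D₀, hKdeg, hKtype, hγ, hlev⟩ := exists_level_bounds L hθ E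
  -- the polynomials `P_N`
  have hch : ∀ N : ℕ, ∃ Q : ℤ[X], D₀ ≤ N → Q ≠ 0 ∧ (Q.natDegree : ℝ) ≤ Kdeg * ((N : ℝ) + 2) ∧
      Real.log (zl1 Q) ≤ Ktype * (((N : ℝ) + 2) * Real.sqrt ((N : ℝ) + 2)) ∧
      Real.log ‖Polynomial.aeval θ Q‖ ≤ -(γ * ((N : ℝ) + 2) ^ 3) := by
    intro N
    by_cases hN : D₀ ≤ N
    · obtain ⟨Q, hQ⟩ := hlev N hN
      exact ⟨Q, fun _ => hQ⟩
    · exact ⟨1, fun h => absurd h hN⟩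
  choose P hP using hch
  -- the sequences
  set K' : ℝ := Kdeg + Ktype + 2 with hK'
  have hK'0 : 0 < K' := by rw [hK']; linarith
  let δ : ℕ → ℝ := fun N => (Kdeg + 1) * ((N : ℝ) + 2)
  let σ : ℕ → ℝ := fun N => K' * (((N : ℝ) + 2) * Real.sqrt ((N : ℝ) + 2))
  have hx2 : ∀ N : ℕ, (2 : ℝ) ≤ (N : ℝ) + 2 := fun N => by linarith [(Nat.cast_nonneg N : (0 : ℝ) ≤ N)]
  have hsqrt1 : ∀ N : ℕ, 1 ≤ Real.sqrt ((N : ℝ) + 2) := fun N => by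
    rw [Real.le_sqrt (by norm_num) (by linarith [hx2 N])]; linarith [hx2 N]
  have hδm : Monotone δ := by
    intro m n h
    simp only [δ]
    gcongr
  have hσm : Monotone σ := by
    intro m n h
    simp only [σ]
    have hmn : (m : ℝ) + 2 ≤ (n : ℝ) + 2 := by exact_mod_cast Nat.add_le_add_right h 2
    have : ((m : ℝ) + 2) * Real.sqrt ((m : ℝ) + 2) ≤ ((n : ℝ) + 2) * Real.sqrt ((n : ℝ) + 2) :=
      mul_le_mul hmn (Real.sqrt_le_sqrt hmn) (Real.sqrt_nonneg _) (by linarith [hx2 n])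
    exact mul_le_mul_of_nonneg_left this hK'0.le
  have hδ0 : ∀ N, 0 < δ N := fun N => by simp only [δ]; positivity
  have hσ0 : ∀ N, 0 < σ N := fun N => by
    simp only [σ]; exact mul_pos hK'0 (mul_pos (by linarith [hx2 N]) (by linarith [hsqrt1 N]))
  have hσge : ∀ N : ℕ, (N : ℝ) ≤ σ N := by
    intro N
    simp only [σ]
    have h1 : ((N : ℝ) + 2) ≤ ((N : ℝ) + 2) * Real.sqrt ((N : ℝ) + 2) :=
      le_mul_of_one_le_right (by linarith [hx2 N]) (hsqrt1 N)
    have h2 : 1 ≤ K' := by rw [hK']; linarith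
    nlinarith
  have hσ : Tendsto σ atTop atTop :=
    tendsto_atTop_mono hσge tendsto_natCast_atTop_atTop
  have hδa : ∀ N, δ (N + 1) ≤ 2 * δ N := by
    intro N; simp only [δ]; push_cast; nlinarith
  have hσa : ∀ N, σ (N + 1) < 2 * σ N := by
    intro N; simp only [σ]; push_cast
    have := sigma_ratio (hx2 N)
    rw [show (N : ℝ) + 1 + 2 = (N : ℝ) + 2 + 1 by ring]
    nlinarith
  -- the threshold `N₀`
  set N₀ : ℕ := D₀ + ⌈(80 * ((Kdeg + 1) * K') / γ) ^ 2⌉₊ with hN₀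
  have hPN : ∀ N, N₀ ≤ N → P N ≠ 0 ∧ ((P N).natDegree : ℝ) < δ N ∧ (P N).gelfondType < σ N := by
    intro N hN
    obtain ⟨hQ0, hQdeg, hQzl1, -⟩ := hP N (le_trans (Nat.le_add_right _ _) hN)
    refine ⟨hQ0, ?_, ?_⟩
    · simp only [δ]
      have : 0 < (N : ℝ) + 2 := by linarith [hx2 N]
      nlinarith
    · unfold Polynomial.gelfondType
      have hsup1 : 1 ≤ (P N).supNorm := Polynomial.one_le_supNorm_of_ne_zero hQ0
      have hlog : Real.log (P N).supNorm ≤ Real.log (zl1 (P N)) :=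
        Real.log_le_log (by linarith) (supNorm_le_zl1 _)
      simp only [σ]
      have h1 : ((N : ℝ) + 2) ≤ ((N : ℝ) + 2) * Real.sqrt ((N : ℝ) + 2) :=
        le_mul_of_one_le_right (by linarith [hx2 N]) (hsqrt1 N)
      have h2 : 0 < ((N : ℝ) + 2) * Real.sqrt ((N : ℝ) + 2) := by nlinarith [hx2 N]
      rw [hK']
      nlinarith
  obtain ⟨N, hN, hle⟩ := Literature.NumberTheory.Transcendental.gelfond_criterion_not_small_values hθ 2 (by norm_num)
    δ σ hδm hσm hδ0 hσ0 hσ hδa hσa P N₀ hPN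
  -- but `|P_N(θ)| ≤ exp(-γ (N+2)³) < exp(-80 δ_N σ_N)`
  obtain ⟨hQ0, -, -, hQval⟩ := hP N (le_trans (Nat.le_add_right _ _) hN)
  have hQθ0 : 0 < ‖Polynomial.aeval θ (P N)‖ := by
    rw [norm_pos_iff]
    exact aeval_ne_zero_of_transcendental hθ hQ0
  have hval : ‖Polynomial.aeval θ (P N)‖ ≤ Real.exp (-(γ * ((N : ℝ) + 2) ^ 3)) :=
    (Real.log_le_iff_le_exp hQθ0).mp hQval
  have hNr : (⌈(80 * ((Kdeg + 1) * K') / γ) ^ 2⌉₊ : ℝ) ≤ N := by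
    have : ⌈(80 * ((Kdeg + 1) * K') / γ) ^ 2⌉₊ ≤ N := le_trans (Nat.le_add_left _ _) hN
    exact_mod_cast this
  have hsq : (80 * ((Kdeg + 1) * K') / γ) ^ 2 < (N : ℝ) + 2 := by
    linarith [Nat.le_ceil ((80 * ((Kdeg + 1) * K') / γ) ^ 2)]
  set t : ℝ := Real.sqrt ((N : ℝ) + 2) with ht
  have ht2 : t ^ 2 = (N : ℝ) + 2 := by rw [ht, Real.sq_sqrt (by linarith [hx2 N])]
  have ht0 : 0 < t := by rw [ht]; exact Real.sqrt_pos.mpr (by linarith [hx2 N])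
  have htgt : 80 * ((Kdeg + 1) * K') / γ < t := by
    have h0 : 0 ≤ 80 * ((Kdeg + 1) * K') / γ := by positivity
    rw [← ht2] at hsq
    nlinarith
  have hexp : Real.exp (-(γ * ((N : ℝ) + 2) ^ 3)) < Real.exp (-40 * 2 * δ N * σ N) := by
    apply Real.exp_lt_exp.mpr
    simp only [δ, σ]
    rw [← ht, ← ht2]
    exact gelfond_gap hγ ht0 htgt
  linarith

/-! ### The reduction to a transcendental `θ` -/

/-- A real number transcendental over `ℤ` is transcendental over `ℚ` as a complex number.
[folklore] -/
lemma transcendental_ofReal {x : ℝ} (hx : Transcendental ℤ x) : Transcendental ℚ (x : ℂ) := by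
  intro h
  obtain ⟨q, hq0, hq⟩ := h
  obtain ⟨k, hk, hQ⟩ := IsLocalization.integerNormalization_spec (nonZeroDivisors ℤ) q
  set Q := IsLocalization.integerNormalization (nonZeroDivisors ℤ) q
  apply hx
  refine ⟨Q, ?_, ?_⟩
  · exact fun h0 => hq0 ((IsLocalization.integerNormalization_eq_zero_iff le_rfl q).mp h0)
  · have h1 : Polynomial.aeval (x : ℂ) Q = (k : ℂ) * Polynomial.aeval (x : ℂ) q := by
      have := congrArg (Polynomial.aeval (x : ℂ)) hQ
      rwa [Polynomial.aeval_map_algebraMap, map_zsmul, zsmul_eq_mul] at this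
    rw [hq, mul_zero] at h1
    have h2 : ((Polynomial.aeval x Q : ℝ) : ℂ) = Polynomial.aeval (x : ℂ) Q := by
      rw [← Complex.coe_algebraMap, ← Polynomial.aeval_algebraMap_apply]
    rw [← h2] at h1
    exact_mod_cast h1

/-- There is a transcendental complex number. [folklore] -/
lemma exists_transcendental : ∃ θ : ℂ, Transcendental ℚ θ :=
  ⟨_, transcendental_ofReal (transcendental_liouvilleNumber (le_refl 2))⟩

/-- **The reduction** (Chudnovsky 1984, Ch. 7, §2, variant (C), p. 307: "if `η/ω` is algebraic
over `ℚ(π/ω)` …"): if no two of the numbers `S i` are algebraically independent over `ℚ`, then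
all of them are algebraic over `ℚ(θ)` for some transcendental `θ` (one of them, or — if all are
algebraic — any transcendental number). [cite: Chudnovsky1984, Ch. 7 §2 p. 307] -/
theorem exists_theta {n : ℕ} (S : Fin n → ℂ)
    (h : ∀ f : Fin 2 → ℂ, Set.range f ⊆ Set.range S → ¬AlgebraicIndependent ℚ f) :
    ∃ θ : ℂ, Transcendental ℚ θ ∧ ∀ i, IsAlgebraic ℚ⟮θ⟯ (S i) := by
  classical
  by_cases hall : ∀ i, IsAlgebraic ℚ (S i)
  · obtain ⟨θ, hθ⟩ := exists_transcendental
    exact ⟨θ, hθ, fun i => (hall i).tower_top (L := ℚ⟮θ⟯)⟩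
  · push Not at hall
    obtain ⟨i, hi⟩ := hall
    have hθ : Transcendental ℚ (S i) := hi
    refine ⟨S i, hθ, fun j => ?_⟩
    -- `![S i]` is algebraically independent, `(S j, S i)` is not
    have hind : AlgebraicIndependent ℚ ![S i] := algebraicIndependent_iff_transcendental.mpr hθ
    have hnot : ¬AlgebraicIndependent ℚ (fun o : Option (Fin 1) => o.elim (S j) ![S i]) := by
      intro hopt
      let e : Fin 2 ≃ Option (Fin 1) := finSuccEquiv 1
      apply h ((fun o : Option (Fin 1) => o.elim (S j) ![S i]) ∘ e) ?_ (hopt.comp _ e.injective)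
      rintro _ ⟨k, rfl⟩
      simp only [Function.comp_apply]
      rcases (e k) with _ | l
      · exact ⟨j, rfl⟩
      · exact ⟨i, by fin_cases l; rfl⟩
    rw [AlgebraicIndependent.option_iff] at hnot
    have halg : IsAlgebraic (Algebra.adjoin ℚ (Set.range ![S i])) (S j) := by
      by_contra hc
      exact hnot ⟨hind, hc⟩
    have hle : Algebra.adjoin ℚ (Set.range ![S i]) ≤ (ℚ⟮S i⟯).toSubalgebra := by
      refine Algebra.adjoin_le ?_
      rintro _ ⟨k, rfl⟩
      fin_cases k
      exact IntermediateField.mem_adjoin_simple_self ℚ (S i)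
    exact halg.tower_top_of_subalgebra_le hle

/-- Integrality of a root of `X² + s`. [folklore] -/
lemma isIntegral_of_sq_add {R : Type*} [CommRing R] [Algebra R ℂ] (s : R) {c : ℂ}
    (hc : c ^ 2 + algebraMap R ℂ s = 0) : IsIntegral R c := by
  refine ⟨Polynomial.X ^ 2 + Polynomial.C s, Polynomial.monic_X_pow_add_C s two_ne_zero, ?_⟩
  simp [hc]

/-- Integrality of a root of `X³ + s X + t`. [folklore] -/
lemma isIntegral_of_cubic {R : Type*} [CommRing R] [Algebra R ℂ] (s t : R) {c : ℂ}
    (hc : c ^ 3 + algebraMap R ℂ s * c + algebraMap R ℂ t = 0) : IsIntegral R c := by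
  refine ⟨Polynomial.X ^ 3 + (Polynomial.C s * Polynomial.X + Polynomial.C t), ?_, ?_⟩
  · refine Polynomial.monic_X_pow_add ?_
    have h1 : (Polynomial.C s * Polynomial.X + Polynomial.C t : Polynomial R).degree ≤ 1 := by
      refine (Polynomial.degree_add_le _ _).trans (max_le (Polynomial.degree_C_mul_X_le s) ?_)
      exact (Polynomial.degree_C_le (a := t)).trans (by norm_num)
    exact h1.trans_lt (by norm_num)
  · simp only [Polynomial.eval₂_add, Polynomial.eval₂_pow, Polynomial.eval₂_X, Polynomial.eval₂_mul,
      Polynomial.eval₂_C]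
    rw [← hc]; ring

/-- From "`g₂, g₃, π/ω₁, η₁/ω₁` algebraic over `K₀`" to "`κ, g₂/2, c, e₁` algebraic over `K₀`"
(`c² = -4(π/ω₁)²`, `4e₁³ - g₂e₁ - g₃ = 0`). [cite: Chudnovsky1984, Ch. 7 Thm 3.1 p. 309] -/
theorem isAlgebraic_xv (K₀ : IntermediateField ℚ ℂ)
    (h : ∀ i, IsAlgebraic K₀ (![L.g₂, L.g₃, (Real.pi : ℂ) / L.ω₁, L.η₁ / L.ω₁] i)) :
    ∀ l, IsAlgebraic K₀ (xv L l) := by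
  -- the algebraic closure of `K₀` in `ℂ`
  obtain ⟨S, hS⟩ : ∃ S : Subalgebra K₀ ℂ, S = integralClosure K₀ ℂ := ⟨_, rfl⟩
  have hmem : ∀ {y : ℂ}, IsAlgebraic K₀ y → y ∈ S := fun hy => by
    rw [hS]; exact hy.isIntegral
  have hmem' : ∀ {y : ℂ}, y ∈ S → IsIntegral K₀ y := fun hy => by
    rw [hS] at hy; exact hy
  haveI : Algebra.IsIntegral K₀ S := by rw [hS]; infer_instance
  have hg₂ : L.g₂ ∈ S := hmem (h 0)
  have hg₃ : L.g₃ ∈ S := hmem (h 1)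
  have hπ : (Real.pi : ℂ) / L.ω₁ ∈ S := hmem (h 2)
  have hκ : L.η₁ / L.ω₁ ∈ S := hmem (h 3)
  have hK : ∀ q : ℚ, ((q : ℂ)) ∈ S := fun q => by
    simpa using S.algebraMap_mem (algebraMap ℚ K₀ q)
  have halg : ∀ {y : ℂ}, IsIntegral S y → IsAlgebraic K₀ y := fun hy =>
    (isIntegral_trans (R := K₀) _ hy).isAlgebraic
  intro l
  fin_cases l
  · -- `κ`
    exact h 3
  · -- `g₂/2`
    show IsAlgebraic K₀ (L.g₂ / 2)
    have : L.g₂ / 2 ∈ S := by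
      rw [div_eq_mul_inv]
      refine S.mul_mem hg₂ ?_
      simpa using hK (1 / 2)
    exact (hmem' this).isAlgebraic
  · -- `c`, with `c² = -4 (π/ω₁)²`
    show IsAlgebraic K₀ (c L)
    have hs : 4 * ((Real.pi : ℂ) / L.ω₁) ^ 2 ∈ S := by
      exact S.mul_mem (by simp) (S.pow_mem hπ 2)
    refine halg (isIntegral_of_sq_add (⟨_, hs⟩ : S) ?_)
    rw [c_sq]
    change -4 * ((Real.pi : ℂ) / L.ω₁) ^ 2 + 4 * ((Real.pi : ℂ) / L.ω₁) ^ 2 = 0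
    ring
  · -- `e₁`, with `4 e₁³ - g₂ e₁ - g₃ = 0`
    show IsAlgebraic K₀ (e₁ L)
    have hs : -(L.g₂ / 4) ∈ S := S.neg_mem (by
      rw [div_eq_mul_inv]; exact S.mul_mem hg₂ (by simpa using hK (1 / 4)))
    have ht : -(L.g₃ / 4) ∈ S := S.neg_mem (by
      rw [div_eq_mul_inv]; exact S.mul_mem hg₃ (by simpa using hK (1 / 4)))
    refine halg (isIntegral_of_cubic (⟨_, hs⟩ : S) (⟨_, ht⟩ : S) ?_)
    have := e₁_cubic L
    change e₁ L ^ 3 + -(L.g₂ / 4) * e₁ L + -(L.g₃ / 4) = 0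
    linear_combination this / 4

/-! ### The theorems -/

/-- **Chudnovsky 1984, Ch. 7, Theorem 3.1** — proved: for every lattice, two of
`g₂, g₃, π/ω₁, η₁/ω₁` are algebraically independent over `ℚ`.
[cite: Chudnovsky1984, Ch. 7 Thm 3.1 p. 309] -/
theorem Chudnovsky1984_thm_7_3_1_holds : Chudnovsky1984_thm_7_3_1 := by
  intro L
  by_contra hcon
  push Not at hcon
  have h' : ∀ f : Fin 2 → ℂ,
      Set.range f ⊆ Set.range ![L.g₂, L.g₃, (Real.pi : ℂ) / L.ω₁, L.η₁ / L.ω₁] →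
        ¬AlgebraicIndependent ℚ f := by
    intro f hf hind
    refine hcon f (hf.trans ?_) hind
    rintro _ ⟨k, rfl⟩
    fin_cases k <;> simp
  obtain ⟨θ, hθ, halg⟩ := exists_theta _ h'
  obtain ⟨E⟩ := exists_envelope θ (xv L) (isAlgebraic_xv L (ℚ⟮θ⟯) halg)
  exact core L hθ E

/-- **Chudnovsky 1984, Ch. 7, Theorem 2.6** — proved: for algebraic `g₂, g₃`, the numbers
`π/ω₁` and `η₁/ω₁` are algebraically independent. [cite: Chudnovsky1984, Ch. 7 Thm 2.6 p. 309] -/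
theorem Chudnovsky1984_thm_7_2_6_holds : Chudnovsky1984_thm_7_2_6 :=
  Chudnovsky1984_thm_7_2_6_of_thm_7_3_1 Chudnovsky1984_thm_7_3_1_holds

/-- **Chudnovsky's theorem on periods and quasi-periods** (Chudnovsky 1976; Chudnovsky 1984,
Ch. 7, Thm 1.16 = Thm 2.1, p. 305): for a lattice with algebraic invariants `g₂, g₃`,
`trdeg_ℚ ℚ(ω₁, ω₂, η₁, η₂) ≥ 2`. This discharges the named fact `Literature.NumberTheory.Transcendental.chudnovsky`
(`KontsevichZagier.lean`, periods.S31). [cite: Chudnovsky1984, Ch. 7 Thm 2.1 p. 305] -/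
theorem chudnovsky_holds : chudnovsky :=
  chudnovsky_of_thm_7_3_1 Chudnovsky1984_thm_7_3_1_holds fun L => L.legendre_relation_holds

end Literature.NumberTheory.Transcendental.Chudnovsky

/-- Alias in the namespace of the named fact: `Literature.NumberTheory.Transcendental.chudnovsky` holds.
[cite: Chudnovsky1984, Ch. 7 Thm 2.1 p. 305] -/
theorem Literature.NumberTheory.Transcendental.chudnovsky_holds : Literature.NumberTheory.Transcendental.chudnovsky :=
  Literature.NumberTheory.Transcendental.Chudnovsky.chudnovsky_holds

end
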